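import Summits.QuantumFields.BalabanUV.Beta.D1BFx.MainTable

/-!
# `BalabanUV.Beta.D1BFx.CrossERestLists` — road «BF-x» for binder row D1, slot (REST), the `RestIdx` member `crossE` (part 1 of 2): THE E-SECTOR CROSS
# WORDS AS GRADED `ℤ⁴` LOCATED-PAIR LISTS — `SbE κ u = realK u u (reix (vec₀ κ ++ div₀ κ ++ rem₀ κ))` with `vec₀`∕`div₀` of grading 1 and `rem₀` of grading
# 2 (an3's `WilsonStencilZ4` certificates + the transpose law `graded_trStn`), the split of an3's bubble `bub (vec₀++div₀++rem₀) (vec₀++div₀++rem₀) − bub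
# vec₀ vec₀ = lonW + remW` into the THREE grade-2 longitudinal words and the FIVE grade-≥3 remainder words, `IsO 7 (remW G)` under the leg budget `DG 3 2 G`
# (an3's `GradedBubbles.isO_seven`), and the exponential envelope of every word through an exponentially bounded constant leg (for (CONV) at fixed block size)

HONEST DEPENDENCY (page 1, mandatory): continuum YM on T⁴ ⇐ BetaPertH ∧ nine spine estimates (0/9 proved); BetaPertH ⇐ (D1) ∧ (D4) ∧
CAP+tail; G-an2-4 gates asym, D1 and NE2/3/4.  HONEST FRAMING (cell contract, verbatim): «discharging `BetaPertH` makes Bałaban's UV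
stability UNCONDITIONAL — a real constructive-QFT result; it is NOT the continuum limit and NOT the Clay problem.»  THIS MODULE DISCHARGES
NOTHING of the wall: FIVE definitions with bodies ([our objects] the lists `vec₀`, `div₀`, `rem₀` — the owner's kernel-level split `MainTable.SbE_eq_vecK_add`
written as ONE located-pair list — and the word sums `lonW`, `remW`) and [folklore] LIST BOOKKEEPING composed BY NAME over an3's LEAF 1∕2
(`GradedBubbles`: `bub`, `Graded`, `IsO`, `DG`, `isO_seven`, `isO_bub_dg3`, `bub_append_*`, `bub_smul_*`; `WilsonStencilZ4`: `graded_vecStn`, `graded_divStn`,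
`graded_remStn`) and the owner's A1.ii chain (`WilsonStencilRealised`: `trStn`, `reixStn`, `realK_append`, `realK_smulS`; `ColourlessAntisymmetry`:
`trStn_append`, `trStn_smulS`, `reixStn_append`, `reixStn_smulS`; `MainTable`: `vecK`, `SbE_eq_vecK_add`).  No `Prop` is minted, nothing is cited, no
hypothesis is a printed statement, 0 sorry.  0 wall binders; NOT the (K) slot, NOT A3.a, NOT D1, NOT `BetaPertH`, NOT continuum, NOT Clay.

ABSOLUTE RULE (cell charter, verbatim): «No internally-minted statement may enter as a cited fact. Every hypothesis is either kernel-proved in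
this package or a verbatim quotation of a PUBLISHED theorem with page reference. The manuscript(s) under audit are NOT citable for their own
disputed steps — they are the thing under adjudication; programme-internal (2001/route/tribunal) claims are never citable.»

WHY (owner d1-p2-g2, `SPLIT-SPEC.md` v1.1 §3 (τ-E1)∕(τ-E2) + §4 «A2: … words containing `REMₐ` via `restK_crossE` + `SbE_split`»; journal l.15231).  The
`crossE` word of `SplitInstance.restK` is `ω_gl·cE²·n⁻⁸·w_μw_ν·(−½)·(bubble A (SbE μ (b+w)) (SbE ν b) − bubble A (vecK μ (b+w)) (vecK ν b))` over the frozen leg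
`A = frozenLeg g`.  With `SbE = VEC + DIVₐ + REMₐ` (part 4b∕5e) the bubble difference is a sum of EIGHT cross bubbles.  The owner's bridge
`StencilRealisation.bubble_realK_realK` turns each into an3's `ℤ⁴` table `bub g g X Y`, where an3's DECAY THEOREM applies by grading: `VEC`, `DIVₐ` are
first-difference lists (grading 1), `REMₐ` a second-difference list (grading 2, `graded_remStn`); a bubble of total grading `≥ 3` through legs with the
difference budget `DG 3 2` is `IsO 7` (`isO_seven`) — ONE POWER BETTER than marginal, hence log-free (part 2: leaf-07's `DegreeSevenCount`).  The five
words with a `REMₐ` factor (`remW`) are of this class; the three LONGITUDINAL words `VEC×DIVₐ`, `DIVₐ×VEC`, `DIVₐ×DIVₐ` (`lonW`, total grading 2, `IsO 6`: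
log-CARRYING individually) are NOT — by the owner's τ-E2 they cancel against the R-sector's local part `SbR_loc := −(cE∕cR)•DIVₐ` inside the words
`restK_bub (0,2,·,·)∕(2,0,·,·)∕(2,2,·,·)`, which is the A3.a author's re-attribution; here they are only NAMED.  This part is the LIST LEVEL: definitions,
gradings, realisation identities, the split, the decay class, and the exponential envelope of every word at a FIXED exponentially bounded leg.
* §1 [folklore] list lemmas: `trStn_rowSh∕_colSh∕_rowDiff∕_colDiff`, **`graded_trStn`** (the transpose swaps row and column differences), `reixStn_trStn`.
* §2 [our objects] `vec₀ κ := vecStn sTot κ 1`, `div₀ κ := ½•(2•divStn κ 1 ++ (−1)•trStn (2•divStn κ 1))`, `rem₀ κ := ½•(remStn κ 1 ++ (−1)•trStn (remStn κ 1))`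
  (lists over `Unit × Fin 4`); `graded_vec₀` (1), `graded_div₀` (1), `graded_rem₀` (2); realisation: `vecK_eq_realK_vec₀`, `realK_reix_div₀`, `realK_reix_rem₀`,
  **`SbE_eq_realK_lists`** (`SbE κ u = realK u u (reixStn ιU (vec₀ κ ++ div₀ κ ++ rem₀ κ))`).
* §3 [our objects] `lonW f μ ν`, `remW f μ ν` and [folklore] **`bub_lists_sub_bub_vec₀`** (`bub (vec₀++div₀++rem₀)μ (…)ν − bub vec₀μ vec₀ν = lonW + remW`),
  **`isO_seven_remW`** (`DG 3 2 f ⇒ IsO 7 (remW f μ ν)`), `isO_six_lonW` (the log class, for the record), `bub_apply_eq_const`∕`lonW_apply_eq_const`∕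
  `remW_apply_eq_const` (a family's word at `(L,k)` is the constant-leg word of its `(L,k)` member), `…_const_apply_eq_zero_idx` (a constant-leg word
  does not see `(L,k)`), `exists_decay_remW` (the `IsO 7` constant made explicit).
* §4 [folklore] THE EXPONENTIAL ENVELOPE at a fixed leg `|g v| ≤ C e^{−δ|v|₁}` (`δ ≥ 0`): `abs_term_const_le`, `exists_envelope_bubRow`, **`exists_envelope_bub`**
  (`∃ C′, ∀ L k w, |bub g g V W L k w| ≤ C′ e^{−δ|w|₁}`), `exists_envelope_lonW`, `exists_envelope_remW`.
Unit `b2b-balaban-beta-d1-formalise-leaf-03` (gen 4), D1 formalisation swarm; `LEAVES-BFx.md` row A2 ∕ (REST) (sub-leaf «D1-BFx-REST-crossE», part 1).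
-/

noncomputable section

namespace Summit.QuantumFields.BalabanUV.Beta.D1BFx.CrossERestLists

open Finset
open scoped BigOperators
open Literature.MathematicalPhysics.QuantumFieldTheory.Balaban1983to89
open Literature.MathematicalPhysics.QuantumFieldTheory.Balaban1983to89.Beta
open B12Sec2to5 (l1 l1_nonneg)
open ExpKernelCalculus (Site MKer l1_sub_triangle l1_sub_symm)
open DyadicShell (Pt supNorm)
open PlaquetteWeitzenbock (sTot)
open GradedBubbles (Fam IsO DG LP Stn term bubRow bub rowSh colSh smulS rowDiff colDiff Graded bub_append_left bub_append_right bub_smul_left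
  bub_smul_right isO_seven isO_bub_dg3)
open Summit.QuantumFields.BalabanUV.Beta.WilsonStencilZ4 (vecStn divStn remStn graded_vecStn graded_divStn graded_remStn)
open Summit.QuantumFields.BalabanUV.Beta.D1BFx.GluonKernelSectors (SbE)
open Summit.QuantumFields.BalabanUV.Beta.D1BFx.StencilRealisation (realK)
open Summit.QuantumFields.BalabanUV.Beta.D1BFx.WilsonStencilRealised (trStn reixStn ιU trStn_nil trStn_cons reixStn_nil reixStn_cons realK_append realK_smulS)
open Summit.QuantumFields.BalabanUV.Beta.D1BFx.ColourlessAntisymmetry (trStn_append trStn_smulS reixStn_append reixStn_smulS)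
open Summit.QuantumFields.BalabanUV.Beta.D1BFx.MainTable (vecK vecK_eq SbE_eq_vecK_add)

/-! ## §1 List lemmas: the transpose of a graded list is graded -/

section Lists

variable {I J : Type*}

/-- [folklore] Transpose of a row translate is the column translate of the transpose. -/
theorem trStn_rowSh (a : Pt) (V : Stn I) : trStn (rowSh a V) = colSh a (trStn V) := by
  induction V with
  | nil => rfl
  | cons p V ih => simp only [rowSh, colSh, trStn, List.map_cons, List.map_map, Function.comp_def] at ih ⊢

/-- [folklore] Transpose of a column translate is the row translate of the transpose. -/
theorem trStn_colSh (a : Pt) (V : Stn I) : trStn (colSh a V) = rowSh a (trStn V) := by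
  induction V with
  | nil => rfl
  | cons p V ih => simp only [rowSh, colSh, trStn, List.map_cons, List.map_map, Function.comp_def] at ih ⊢

/-- [folklore] Transpose of a row difference is the column difference of the transpose. -/
theorem trStn_rowDiff (a : Pt) (V : Stn I) : trStn (rowDiff a V) = colDiff a (trStn V) := by
  rw [rowDiff, colDiff, trStn_append, trStn_rowSh, trStn_smulS]

/-- [folklore] Transpose of a column difference is the row difference of the transpose. -/
theorem trStn_colDiff (a : Pt) (V : Stn I) : trStn (colDiff a V) = rowDiff a (trStn V) := by
  rw [rowDiff, colDiff, trStn_append, trStn_colSh, trStn_smulS]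

/-- [folklore] **THE TRANSPOSE OF A GRADED LIST IS GRADED (same grade)** — row and column differences swap rôles (induction on an3's `Graded`). -/
theorem graded_trStn {n : ℕ} {V : Stn I} (h : Graded n V) : Graded n (trStn V) := by
  induction h with
  | zero V => exact Graded.zero _
  | weaken _ ih => exact Graded.weaken ih
  | rowDiff ha _ ih => rw [trStn_rowDiff]; exact Graded.colDiff ha ih
  | colDiff ha _ ih => rw [trStn_colDiff]; exact Graded.rowDiff ha ih
  | rowSh a _ ih => rw [trStn_rowSh]; exact Graded.colSh a ih
  | colSh a _ ih => rw [trStn_colSh]; exact Graded.rowSh a ih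
  | append _ _ ih1 ih2 => rw [trStn_append]; exact Graded.append ih1 ih2
  | smul c _ ih => rw [trStn_smulS]; exact Graded.smul c ih

/-- [folklore] Internal re-indexing commutes with the transpose. -/
theorem reixStn_trStn (f : J → I) (V : Stn I) : reixStn f (trStn V) = trStn (reixStn f V) := by
  induction V with
  | nil => rfl
  | cons p V ih => rw [trStn_cons, reixStn_cons, reixStn_cons, trStn_cons, ih, Matrix.transpose_submatrix]

end Lists

/-! ## §2 The three E-sector lists and their realisation -/

/-- [our object] THE MODEL-VECTOR LIST at the colourless instance: `vec₀ κ := vecStn sTot κ 1` (so that `vecK κ u = realK u u (reixStn ιU (vec₀ κ))`). -/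
def vec₀ (κ : Fin 4) : Stn (Unit × Fin 4) := vecStn sTot κ (1 : Matrix Unit Unit ℝ)

/-- [our object] THE ANTISYMMETRISED LONGITUDINAL LIST: `div₀ κ := ½•(2•divStn κ 1 ++ (−1)•trStn (2•divStn κ 1))` (realises the owner's `DIVₐ`). -/
def div₀ (κ : Fin 4) : Stn (Unit × Fin 4) :=
  smulS (1 / 2) (smulS 2 (divStn κ (1 : Matrix Unit Unit ℝ)) ++ smulS (-1) (trStn (smulS 2 (divStn κ (1 : Matrix Unit Unit ℝ)))))

/-- [our object] THE ANTISYMMETRISED REMAINDER LIST: `rem₀ κ := ½•(remStn κ 1 ++ (−1)•trStn (remStn κ 1))` (realises the owner's `REMₐ`). -/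
def rem₀ (κ : Fin 4) : Stn (Unit × Fin 4) :=
  smulS (1 / 2) (remStn κ (1 : Matrix Unit Unit ℝ) ++ smulS (-1) (trStn (remStn κ (1 : Matrix Unit Unit ℝ))))

/-- [folklore] `vec₀` has grading 1 (an3 `graded_vecStn`). -/
theorem graded_vec₀ (κ : Fin 4) : Graded 1 (vec₀ κ) := graded_vecStn _ _ _

/-- [folklore] `div₀` has grading 1 (an3 `graded_divStn` + `graded_trStn`). -/
theorem graded_div₀ (κ : Fin 4) : Graded 1 (div₀ κ) :=
  Graded.smul _ (Graded.append (Graded.smul _ (graded_divStn _ _)) (Graded.smul _ (graded_trStn (Graded.smul _ (graded_divStn _ _)))))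

/-- [folklore] `rem₀` has grading 2 (an3 `graded_remStn` + `graded_trStn`). -/
theorem graded_rem₀ (κ : Fin 4) : Graded 2 (rem₀ κ) :=
  Graded.smul _ (Graded.append (graded_remStn _ _) (Graded.smul _ (graded_trStn (graded_remStn _ _))))

/-- [our object] `vecK κ u = realK u u (reixStn ιU (vec₀ κ))` (the owner's `MainTable.vecK_eq`). -/
theorem vecK_eq_realK_vec₀ (κ : Fin 4) (u : Pt) : vecK κ u = realK u u (reixStn ιU (vec₀ κ)) := rfl

/-- [folklore] `div₀` realises the owner's antisymmetrised longitudinal block `DIVₐ` (= `D − Dᵀ` with `D` the realised longitudinal list). -/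
theorem realK_reix_div₀ (κ : Fin 4) (u : Pt) :
    realK u u (reixStn ιU (div₀ κ)) =
      realK u u (reixStn ιU (divStn κ (1 : Matrix Unit Unit ℝ))) - realK u u (trStn (reixStn ιU (divStn κ (1 : Matrix Unit Unit ℝ)))) := by
  simp only [div₀, reixStn_smulS, reixStn_append, reixStn_trStn, trStn_smulS, realK_smulS, realK_append, smul_add, smul_smul]
  norm_num
  abel

/-- [folklore] `rem₀` realises the owner's antisymmetrised remainder block `REMₐ` (= `½(R − Rᵀ)`). -/
theorem realK_reix_rem₀ (κ : Fin 4) (u : Pt) :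
    realK u u (reixStn ιU (rem₀ κ)) =
      (1 / 2 : ℝ) • (realK u u (reixStn ιU (remStn κ (1 : Matrix Unit Unit ℝ)))
        - realK u u (trStn (reixStn ιU (remStn κ (1 : Matrix Unit Unit ℝ))))) := by
  simp only [rem₀, reixStn_smulS, reixStn_append, reixStn_trStn, realK_smulS, realK_append, neg_one_smul, sub_eq_add_neg]

/-- [folklore] **THE ROAD'S WILSON FINE STENCIL IS THE REALISATION OF ONE LIST**: `SbE κ u = realK u u (reixStn ιU (vec₀ κ ++ div₀ κ ++ rem₀ κ))`
(the owner's `SbE_eq_vecK_add`, re-listed). -/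
theorem SbE_eq_realK_lists (κ : Fin 4) (u : Pt) : SbE κ u = realK u u (reixStn ιU (vec₀ κ ++ div₀ κ ++ rem₀ κ)) := by
  rw [reixStn_append, reixStn_append, realK_append, realK_append, ← vecK_eq_realK_vec₀, realK_reix_div₀, realK_reix_rem₀, SbE_eq_vecK_add,
    reixStn_smulS, realK_smulS, trStn_smulS, realK_smulS, ← smul_sub, smul_smul]
  norm_num

/-! ## §3 The longitudinal and remainder word sums; the split; the decay class -/

/-- [our object] **THE THREE LONGITUDINAL CROSS WORDS** (total grading 2 — log-CARRYING individually; τ-E2: to be cancelled against `SbR_loc`, A3.a):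
`lonW f μ ν := bub vec₀μ div₀ν + bub div₀μ vec₀ν + bub div₀μ div₀ν` through the leg family `f` (both legs). -/
def lonW (f : Fam) (μ ν : Fin 4) : Fam :=
  bub f f (vec₀ μ) (div₀ ν) + bub f f (div₀ μ) (vec₀ ν) + bub f f (div₀ μ) (div₀ ν)

/-- [our object] **THE FIVE REMAINDER CROSS WORDS** (total grading ≥ 3 — the A2 class):
`remW f μ ν := bub vec₀μ rem₀ν + bub div₀μ rem₀ν + bub rem₀μ vec₀ν + bub rem₀μ div₀ν + bub rem₀μ rem₀ν`. -/
def remW (f : Fam) (μ ν : Fin 4) : Fam :=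
  bub f f (vec₀ μ) (rem₀ ν) + bub f f (div₀ μ) (rem₀ ν) + bub f f (rem₀ μ) (vec₀ ν) + bub f f (rem₀ μ) (div₀ ν) + bub f f (rem₀ μ) (rem₀ ν)

/-- [folklore] **THE SPLIT OF THE E×E BUBBLE MINUS THE MODEL VECTOR BUBBLE** (bilinearity of an3's `bub` over list concatenation):
`bub (vec₀++div₀++rem₀)μ (vec₀++div₀++rem₀)ν − bub vec₀μ vec₀ν = lonW + remW`. -/
theorem bub_lists_sub_bub_vec₀ (f : Fam) (μ ν : Fin 4) :
    bub f f (vec₀ μ ++ div₀ μ ++ rem₀ μ) (vec₀ ν ++ div₀ ν ++ rem₀ ν) - bub f f (vec₀ μ) (vec₀ ν) = lonW f μ ν + remW f μ ν := by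
  simp only [bub_append_left, bub_append_right, lonW, remW]
  abel

/-- [folklore] **THE REMAINDER WORDS ARE `IsO 7`** through any leg family with the difference budget `DG 3 2` (an3 `isO_seven`: gradings (1,2), (1,2), (2,1),
(2,1), (2,2) — all of total `≥ 3`). -/
theorem isO_seven_remW {f : Fam} (hf : DG 3 2 f) (μ ν : Fin 4) : IsO 7 (remW f μ ν) :=
  ((((isO_seven (graded_vec₀ μ) (graded_rem₀ ν) (by norm_num) hf hf).add
    (isO_seven (graded_div₀ μ) (graded_rem₀ ν) (by norm_num) hf hf)).add
    (isO_seven (graded_rem₀ μ) (graded_vec₀ ν) (by norm_num) hf hf)).add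
    (isO_seven (graded_rem₀ μ) (graded_div₀ ν) (by norm_num) hf hf)).add
    (isO_seven (graded_rem₀ μ) (graded_rem₀ ν) (by norm_num) hf hf)

/-- [folklore] FOR THE RECORD: the longitudinal words are only `IsO 6` (total grading 2; an3 `isO_bub_dg3`) — the marginal, log-carrying class. -/
theorem isO_six_lonW {f : Fam} (hf : DG 3 2 f) (μ ν : Fin 4) : IsO 6 (lonW f μ ν) :=
  ((isO_bub_dg3 (graded_vec₀ μ) (graded_div₀ ν) hf hf).add (isO_bub_dg3 (graded_div₀ μ) (graded_vec₀ ν) hf hf)).add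
    (isO_bub_dg3 (graded_div₀ μ) (graded_div₀ ν) hf hf)

/-- [folklore] `IsO 7` made explicit: ONE constant `A ≥ 0` with `|remW f μ ν L k w| ≤ A/‖w‖∞⁷` for all `(L, k)` and all `w ≠ 0`. -/
theorem exists_decay_remW {f : Fam} (hf : DG 3 2 f) (μ ν : Fin 4) :
    ∃ A : ℝ, 0 ≤ A ∧ ∀ (L k : ℕ) (w : Pt), w ≠ 0 → |remW f μ ν L k w| ≤ A / (supNorm w : ℝ) ^ 7 := by
  obtain ⟨A, hA, -, hdec⟩ := isO_seven_remW hf μ ν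
  exact ⟨A, hA, hdec⟩

section Const

variable {I : Type*} [Fintype I]

/-- [folklore] A family's bubble at `(L, k)` is the constant-leg bubble of its `(L, k)` member. -/
theorem bub_apply_eq_const (f₁ f₂ : Fam) (V W : Stn I) (L k : ℕ) (w : Pt) :
    bub f₁ f₂ V W L k w = bub (fun _ _ => f₁ L k) (fun _ _ => f₂ L k) V W L k w := by
  induction V with
  | nil => rfl
  | cons p V ih =>
    have hrow : ∀ W : Stn I, bubRow f₁ f₂ p W L k w = bubRow (fun _ _ => f₁ L k) (fun _ _ => f₂ L k) p W L k w := by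
      intro W
      induction W with
      | nil => rfl
      | cons q W ihW => simp only [bubRow, Pi.add_apply, ihW]; rfl
    simp only [bub, Pi.add_apply, ih, hrow]

end Const

/-- [folklore] The same for the longitudinal word sum. -/
theorem lonW_apply_eq_const (f : Fam) (μ ν : Fin 4) (L k : ℕ) (w : Pt) : lonW f μ ν L k w = lonW (fun _ _ => f L k) μ ν L k w := by
  simp only [lonW, Pi.add_apply, bub_apply_eq_const f f]

/-- [folklore] The same for the remainder word sum. -/
theorem remW_apply_eq_const (f : Fam) (μ ν : Fin 4) (L k : ℕ) (w : Pt) : remW f μ ν L k w = remW (fun _ _ => f L k) μ ν L k w := by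
  simp only [remW, Pi.add_apply, bub_apply_eq_const f f]

section ConstIdx

variable {I : Type*} [Fintype I]

/-- [folklore] A constant-leg bubble does not see the dummy indices `(L, k)`. -/
theorem bub_const_apply_eq_zero_idx (g₁ g₂ : Pt → ℝ) (V W : Stn I) (L k : ℕ) (w : Pt) :
    bub (fun _ _ => g₁) (fun _ _ => g₂) V W L k w = bub (fun _ _ => g₁) (fun _ _ => g₂) V W 0 0 w := by
  induction V with
  | nil => rfl
  | cons p V ih =>
    have hrow : ∀ W : Stn I, bubRow (fun _ _ => g₁) (fun _ _ => g₂) p W L k w = bubRow (fun _ _ => g₁) (fun _ _ => g₂) p W 0 0 w := by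
      intro W
      induction W with
      | nil => rfl
      | cons q W ihW => simp only [bubRow, Pi.add_apply, ihW]; rfl
    simp only [bub, Pi.add_apply, ih, hrow]

end ConstIdx

/-- [folklore] A constant-leg longitudinal word does not see the dummy indices `(L, k)`. -/
theorem lonW_const_apply_eq_zero_idx (g : Pt → ℝ) (μ ν : Fin 4) (L k : ℕ) (w : Pt) :
    lonW (fun _ _ => g) μ ν L k w = lonW (fun _ _ => g) μ ν 0 0 w := by
  simp only [lonW, Pi.add_apply]
  rw [bub_const_apply_eq_zero_idx g g (vec₀ μ) (div₀ ν) L k w, bub_const_apply_eq_zero_idx g g (div₀ μ) (vec₀ ν) L k w,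
    bub_const_apply_eq_zero_idx g g (div₀ μ) (div₀ ν) L k w]

/-- [folklore] A constant-leg remainder word does not see the dummy indices `(L, k)`. -/
theorem remW_const_apply_eq_zero_idx (g : Pt → ℝ) (μ ν : Fin 4) (L k : ℕ) (w : Pt) :
    remW (fun _ _ => g) μ ν L k w = remW (fun _ _ => g) μ ν 0 0 w := by
  simp only [remW, Pi.add_apply]
  rw [bub_const_apply_eq_zero_idx g g (vec₀ μ) (rem₀ ν) L k w, bub_const_apply_eq_zero_idx g g (div₀ μ) (rem₀ ν) L k w,
    bub_const_apply_eq_zero_idx g g (rem₀ μ) (vec₀ ν) L k w, bub_const_apply_eq_zero_idx g g (rem₀ μ) (div₀ ν) L k w,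
    bub_const_apply_eq_zero_idx g g (rem₀ μ) (rem₀ ν) L k w]

/-! ## §4 The exponential envelope of every word through an exponentially bounded constant leg -/

section Envelope

variable {I : Type*} [Fintype I] {g : Pt → ℝ} {C δ : ℝ}

/-- [folklore] One located pair against one located pair through the constant leg `|g v| ≤ C e^{−δ|v|₁}` (`δ ≥ 0`):
`|term g g p q L k w| ≤ |tr(m_p m_q)|·C²·e^{δ|x_p − y_q|₁}·e^{−δ|w|₁}`. -/
theorem abs_term_const_le (hδ : 0 ≤ δ) (hg : ∀ v, |g v| ≤ C * Real.exp (-δ * l1 v)) (p q : LP I) (L k : ℕ) (w : Pt) :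
    |term (fun _ _ => g) (fun _ _ => g) p q L k w| ≤
      |(p.m * q.m).trace| * (C ^ 2 * Real.exp (δ * l1 (p.x - q.y))) * Real.exp (-δ * l1 w) := by
  have hC : 0 ≤ C := by
    have h := hg 0
    have h1 : Real.exp (-δ * l1 (0 : Pt)) = 1 := by simp [l1]
    rw [h1, mul_one] at h
    exact (abs_nonneg _).trans h
  have h1 : |g (p.x - q.y - w)| ≤ C * (Real.exp (δ * l1 (p.x - q.y)) * Real.exp (-δ * l1 w)) := by
    refine (hg _).trans (mul_le_mul_of_nonneg_left ?_ hC)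
    rw [← Real.exp_add]
    apply Real.exp_le_exp.mpr
    have ht : l1 (w - 0) ≤ l1 (w - (p.x - q.y)) + l1 ((p.x - q.y) - 0) := l1_sub_triangle w (p.x - q.y) 0
    rw [sub_zero, sub_zero, l1_sub_symm w (p.x - q.y)] at ht
    nlinarith
  have h2 : |g (w + (q.x - p.y))| ≤ C := by
    refine (hg _).trans ?_
    have : Real.exp (-δ * l1 (w + (q.x - p.y))) ≤ 1 := Real.exp_le_one_iff.mpr (by nlinarith [l1_nonneg (w + (q.x - p.y))])
    nlinarith
  unfold GradedBubbles.term
  rw [abs_mul, abs_mul]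
  calc |(p.m * q.m).trace| * (|g (p.x - q.y - w)| * |g (w + (q.x - p.y))|)
      ≤ |(p.m * q.m).trace| * (C * (Real.exp (δ * l1 (p.x - q.y)) * Real.exp (-δ * l1 w)) * C) :=
        mul_le_mul_of_nonneg_left (mul_le_mul h1 h2 (abs_nonneg _) (by positivity)) (abs_nonneg _)
    _ = |(p.m * q.m).trace| * (C ^ 2 * Real.exp (δ * l1 (p.x - q.y))) * Real.exp (-δ * l1 w) := by ring

/-- [folklore] One located pair against a list: an exponential envelope in `w`. -/
theorem exists_envelope_bubRow (hδ : 0 ≤ δ) (hg : ∀ v, |g v| ≤ C * Real.exp (-δ * l1 v)) (p : LP I) (W : Stn I) :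
    ∃ C' : ℝ, 0 ≤ C' ∧ ∀ (L k : ℕ) (w : Pt), |bubRow (fun _ _ => g) (fun _ _ => g) p W L k w| ≤ C' * Real.exp (-δ * l1 w) := by
  induction W with
  | nil => exact ⟨0, le_rfl, fun L k w => by simp [bubRow]⟩
  | cons q W ih =>
    obtain ⟨C', hC', h⟩ := ih
    refine ⟨|(p.m * q.m).trace| * (C ^ 2 * Real.exp (δ * l1 (p.x - q.y))) + C', by positivity, fun L k w => ?_⟩
    rw [bubRow, Pi.add_apply, Pi.add_apply, Pi.add_apply, add_mul]
    exact (abs_add_le _ _).trans (add_le_add (abs_term_const_le hδ hg p q L k w) (h L k w))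

/-- [folklore] **THE EXPONENTIAL ENVELOPE OF A BUBBLE WORD** through the constant leg `|g v| ≤ C e^{−δ|v|₁}` (`δ ≥ 0`):
`∃ C′ ≥ 0, ∀ L k w, |bub g g V W L k w| ≤ C′ e^{−δ|w|₁}` — for (CONV) at a fixed block size; the constant is NOT uniform in anything. -/
theorem exists_envelope_bub (hδ : 0 ≤ δ) (hg : ∀ v, |g v| ≤ C * Real.exp (-δ * l1 v)) (V W : Stn I) :
    ∃ C' : ℝ, 0 ≤ C' ∧ ∀ (L k : ℕ) (w : Pt), |bub (fun _ _ => g) (fun _ _ => g) V W L k w| ≤ C' * Real.exp (-δ * l1 w) := by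
  induction V with
  | nil => exact ⟨0, le_rfl, fun L k w => by simp [bub]⟩
  | cons p V ih =>
    obtain ⟨C₁, hC₁, h₁⟩ := exists_envelope_bubRow hδ hg p W
    obtain ⟨C₂, hC₂, h₂⟩ := ih
    refine ⟨C₁ + C₂, by positivity, fun L k w => ?_⟩
    rw [bub, Pi.add_apply, Pi.add_apply, Pi.add_apply, add_mul]
    exact (abs_add_le _ _).trans (add_le_add (h₁ L k w) (h₂ L k w))

end Envelope

section EnvelopeWords

variable {g : Pt → ℝ} {C δ : ℝ}

/-- [folklore] The envelope of a sum of two enveloped families. -/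
theorem exists_envelope_add {F G : Fam} (hF : ∃ C' : ℝ, 0 ≤ C' ∧ ∀ (L k : ℕ) (w : Pt), |F L k w| ≤ C' * Real.exp (-δ * l1 w))
    (hG : ∃ C' : ℝ, 0 ≤ C' ∧ ∀ (L k : ℕ) (w : Pt), |G L k w| ≤ C' * Real.exp (-δ * l1 w)) :
    ∃ C' : ℝ, 0 ≤ C' ∧ ∀ (L k : ℕ) (w : Pt), |(F + G) L k w| ≤ C' * Real.exp (-δ * l1 w) := by
  obtain ⟨C₁, hC₁, h₁⟩ := hF
  obtain ⟨C₂, hC₂, h₂⟩ := hG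
  refine ⟨C₁ + C₂, by positivity, fun L k w => ?_⟩
  rw [Pi.add_apply, Pi.add_apply, Pi.add_apply, add_mul]
  exact (abs_add_le _ _).trans (add_le_add (h₁ L k w) (h₂ L k w))

/-- [folklore] The exponential envelope of the longitudinal word sum at a fixed exponentially bounded leg. -/
theorem exists_envelope_lonW (hδ : 0 ≤ δ) (hg : ∀ v, |g v| ≤ C * Real.exp (-δ * l1 v)) (μ ν : Fin 4) :
    ∃ C' : ℝ, 0 ≤ C' ∧ ∀ (L k : ℕ) (w : Pt), |lonW (fun _ _ => g) μ ν L k w| ≤ C' * Real.exp (-δ * l1 w) := by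
  unfold lonW
  exact exists_envelope_add (exists_envelope_add (exists_envelope_bub hδ hg _ _) (exists_envelope_bub hδ hg _ _)) (exists_envelope_bub hδ hg _ _)

/-- [folklore] The exponential envelope of the remainder word sum at a fixed exponentially bounded leg. -/
theorem exists_envelope_remW (hδ : 0 ≤ δ) (hg : ∀ v, |g v| ≤ C * Real.exp (-δ * l1 v)) (μ ν : Fin 4) :
    ∃ C' : ℝ, 0 ≤ C' ∧ ∀ (L k : ℕ) (w : Pt), |remW (fun _ _ => g) μ ν L k w| ≤ C' * Real.exp (-δ * l1 w) := by
  unfold remW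
  exact exists_envelope_add (exists_envelope_add (exists_envelope_add (exists_envelope_add (exists_envelope_bub hδ hg _ _)
    (exists_envelope_bub hδ hg _ _)) (exists_envelope_bub hδ hg _ _)) (exists_envelope_bub hδ hg _ _)) (exists_envelope_bub hδ hg _ _)

end EnvelopeWords

end Summit.QuantumFields.BalabanUV.Beta.D1BFx.CrossERestLists

end
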